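import Literature.Probability.RandomPlanarGeometry.LoopConfigurations
import Mathlib.Analysis.SpecificLimits.Basic
import Mathlib.Topology.Algebra.InfiniteSum.Real
import HarnessLib

/-!
# Completeness of the spaces of based and unbased loops; limits of `d`-chains

Topic `Literature/Probability/RandomPlanarGeometry` (proofs only; no definition, no named fact).
The space `BasedLoop E` of loop classes with the *unbased oriented* distance `loopDist`
(infimum over rotations of the circle of the reparametrisation distance; DKKMO,
arXiv:2012.11672v2, eq. (1), oriented version) and its metric quotient `UnbasedLoop E` are
**complete** when `E` is (`BasedLoop.completeSpace`, `UnbasedLoop.completeSpace`; theorems, to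
be used via `haveI`): for a
sequence with `dist (u n) (u (n+1)) < 2⁻ⁿ` one chooses representatives inductively — a rotation
and a reparametrisation of a representative of `u (n+1)` within sup-distance `2⁻ⁿ` of the
representative already chosen for `u n` (`Curve.exists_isLoop_loopDist_eq_zero_dist_lt`) — which
converge uniformly (completeness of `C([0,1], E)`) to a loop whose class is the limit; this is
the argument of Aizenman–Burchard (Duke Math. J. 99 (1999), §2.a, p. 12) for the based space
`CurveClass E` (`Curve.instCompleteSpace`), run on the circle.

Consequence for DKKMO's unoriented distance `d = UnbasedLoop.udist` (the minimum of the
distances to a loop and to its reversal, not itself a metric on oriented loops):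
**`d`-chains converge** (`UnbasedLoop.exists_forall_udist_le_tsum`,
`UnbasedLoop.exists_forall_udist_le_of_le_geometric_two`): if `d(u n, u (n+1)) ≤ d n` with
`Σ d n < ∞` then some unbased loop `v` has `d(u n, v) ≤ Σ_{m ≥ n} d m` for every `n` (fix the
orientations along the chain so that it becomes Cauchy for `dist`). This is the elementary
completeness input of the thermodynamic limit for laws of loop configurations in the coupling
distance `d_CN` (Camia–Newman, CMP 268 (2006), Thm 6).

## References

* M. Aizenman, A. Burchard, Duke Math. J. 99 (1999) 419–453, §2.a p. 12 and §4 p. 22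
  [AizenmanBurchardDuke1999].
* H. Duminil-Copin, K. K. Kozlowski, D. Krachun, I. Manolescu, M. Oulamara, arXiv:2012.11672v2
  (2026), §1.2, eq. (1) [arXiv201211672v2].
* F. Camia, C. M. Newman, Comm. Math. Phys. 268 (2006) 1–38, Thm 6 [CamiaNewman2006].
-/

noncomputable section

open Filter Set
open scoped Topology unitInterval

namespace Literature.Probability.RandomPlanarGeometry

variable {E : Type*} [MetricSpace E]

/-! ### Representatives of based loops -/

namespace Curve

/-- **One step of the choice of representatives.** If the loops `α`, `β` have unbased oriented
distance `loopDist α β < r`, then some rotation-and-reparametrisation `α'` of `β` — a loop with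
`loopDist α' β = 0`, i.e. a representative of the same unbased loop — is within sup-distance `r`
of `α` as a parametrised map. [folklore] -/
theorem exists_isLoop_loopDist_eq_zero_dist_lt {α β : Curve E} (hβ : β.IsLoop) {r : ℝ}
    (h : loopDist α β < r) :
    ∃ α' : Curve E, α'.IsLoop ∧ loopDist α' β = 0 ∧
      dist α.toContinuousMap α'.toContinuousMap < r := by
  obtain ⟨b, hb⟩ := exists_lt_of_ciInf_lt h
  obtain ⟨φ, hφ⟩ := exists_dist_reparam_lt (γ₁ := α) (γ₂ := β.shift b) hb
  refine ⟨(β.shift b).reparam φ, isLoop_reparam (isLoop_shift hβ _) φ, ?_, hφ⟩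
  have h0 : reparamDist ((β.shift b).reparam φ) (β.shift b) = 0 := by
    rw [← dist_def, dist_comm]
    exact dist_reparam_self _ _
  rw [loopDist_eq_of_reparamDist_eq_zero β h0, loopDist_shift_left hβ hβ, loopDist_self]

end Curve

namespace BasedLoop

/-- Every based loop is the class of a (loop) curve. [folklore] -/
theorem exists_mk_eq (ℓ : BasedLoop E) : ∃ β : Curve E, CurveClass.mk β = ℓ.toCurveClass :=
  CurveClass.surjective_mk _

/-- A representative of a based loop is a loop. [folklore] -/
theorem isLoop_of_mk_eq {ℓ : BasedLoop E} {β : Curve E} (h : CurveClass.mk β = ℓ.toCurveClass) :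
    β.IsLoop :=
  CurveClass.isLoop_mk.1 (h ▸ ℓ.isLoop)

/-- The distance of based loops is the unbased oriented distance of representatives. [folklore] -/
theorem dist_eq_loopDist {ℓ ℓ' : BasedLoop E} {β β' : Curve E}
    (h : CurveClass.mk β = ℓ.toCurveClass) (h' : CurveClass.mk β' = ℓ'.toCurveClass) :
    dist ℓ ℓ' = Curve.loopDist β β' := by
  rw [dist_def, ← h, ← h']
  rfl

/-- Distance of the based loops of two loop curves. [folklore] -/
theorem dist_mk_mk_mk_mk {α β : Curve E} (hα : (CurveClass.mk α).IsLoop)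
    (hβ : (CurveClass.mk β).IsLoop) :
    dist (mk (CurveClass.mk α) hα) (mk (CurveClass.mk β) hβ) = Curve.loopDist α β :=
  dist_eq_loopDist rfl rfl

/-- **Completeness of the space of based loops with the unbased oriented distance**
(Aizenman–Burchard's completeness argument run on the circle, see the module docstring).
A theorem, not an instance (use via `haveI`), like `LoopSpace.completeSpace`. [cite: AizenmanBurchardDuke1999, §2.a p. 12] -/
theorem completeSpace [CompleteSpace E] : CompleteSpace (BasedLoop E) := by
  refine Metric.complete_of_convergent_controlled_sequences (fun n ↦ (1 / 2 : ℝ) ^ n)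
    (fun n ↦ by positivity) fun u hu ↦ ?_
  -- representatives of the given based loops
  choose β hβ using fun n ↦ exists_mk_eq (u n)
  have hβl : ∀ n, (β n).IsLoop := fun n ↦ isLoop_of_mk_eq (hβ n)
  have hdist : ∀ n, Curve.loopDist (β n) (β (n + 1)) < (1 / 2 : ℝ) ^ n := fun n ↦ by
    rw [← dist_eq_loopDist (hβ n) (hβ (n + 1))]
    exact hu n n (n + 1) le_rfl n.le_succ
  -- inductive choice of well-parametrised representatives
  let S : ℕ → Type _ := fun n ↦ {α : Curve E // α.IsLoop ∧ Curve.loopDist α (β n) = 0}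
  have hstep : ∀ n (a : S n), ∃ a' : S (n + 1),
      dist a.1.toContinuousMap a'.1.toContinuousMap < (1 / 2 : ℝ) ^ n := by
    intro n a
    have hlt : Curve.loopDist a.1 (β (n + 1)) < (1 / 2 : ℝ) ^ n := by
      calc Curve.loopDist a.1 (β (n + 1))
          ≤ Curve.loopDist a.1 (β n) + Curve.loopDist (β n) (β (n + 1)) :=
            Curve.loopDist_triangle _ (hβl n) (hβl (n + 1))
        _ < (1 / 2 : ℝ) ^ n := by rw [a.2.2, zero_add]; exact hdist n
    obtain ⟨α', hα', h0, hd⟩ := Curve.exists_isLoop_loopDist_eq_zero_dist_lt (hβl (n + 1)) hlt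
    exact ⟨⟨α', hα', h0⟩, hd⟩
  choose next hnext using hstep
  let sq : ∀ n, S n := fun n ↦ Nat.rec ⟨β 0, hβl 0, Curve.loopDist_self _⟩ next n
  have hsq_succ : ∀ n, sq (n + 1) = next n (sq n) := fun n ↦ rfl
  -- the parametrised representatives form a Cauchy sequence for the sup distance
  set w : ℕ → C(unitInterval, E) := fun n ↦ (sq n).1.toContinuousMap with hw
  have hw_succ : ∀ n, dist (w n) (w (n + 1)) ≤ 1 * (1 / 2 : ℝ) ^ n := fun n ↦ by
    rw [one_mul, hw]
    dsimp only
    rw [hsq_succ]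
    exact (hnext n (sq n)).le
  obtain ⟨g, hg⟩ := cauchySeq_tendsto_of_complete
    (cauchySeq_of_le_geometric (1 / 2 : ℝ) 1 (by norm_num) hw_succ)
  -- the limit is a loop
  have hg0 : Tendsto (fun n ↦ w n 0) atTop (𝓝 (g 0)) :=
    (continuous_eval_const (0 : unitInterval)).continuousAt.tendsto.comp hg
  have hg1 : Tendsto (fun n ↦ w n 1) atTop (𝓝 (g 1)) :=
    (continuous_eval_const (1 : unitInterval)).continuousAt.tendsto.comp hg
  have heq : (fun n ↦ w n 0) = fun n ↦ w n 1 := funext fun n ↦ (sq n).2.1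
  rw [heq] at hg0
  have hloop : (CurveClass.mk (⟨g⟩ : Curve E)).IsLoop :=
    CurveClass.isLoop_mk.2 (tendsto_nhds_unique hg0 hg1)
  have hsql : ∀ n, (CurveClass.mk (sq n).1).IsLoop := fun n ↦ CurveClass.isLoop_mk.2 (sq n).2.1
  -- and its based loop is the limit
  refine ⟨mk _ hloop, tendsto_iff_dist_tendsto_zero.2 ?_⟩
  refine squeeze_zero (fun n ↦ dist_nonneg) (fun n ↦ ?_) (tendsto_iff_dist_tendsto_zero.1 hg)
  have h1 : dist (u n) (mk _ (hsql n)) = 0 := by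
    rw [dist_eq_loopDist (hβ n) (toCurveClass_mk _ (hsql n)).symm,
      Curve.loopDist_comm (hβl n) (sq n).2.1]
    exact (sq n).2.2
  calc dist (u n) (mk _ hloop)
      ≤ dist (u n) (mk _ (hsql n)) + dist (mk _ (hsql n)) (mk _ hloop) := dist_triangle _ _ _
    _ = Curve.loopDist (sq n).1 ⟨g⟩ := by rw [h1, zero_add, dist_mk_mk_mk_mk]
    _ ≤ dist (sq n).1 (⟨g⟩ : Curve E) := Curve.loopDist_le_reparamDist _ _
    _ ≤ dist (w n) g := Curve.dist_le_dist_toContinuousMap _ _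

end BasedLoop

namespace UnbasedLoop

/-- **Completeness of the space of unbased oriented loops** (the metric quotient of the complete
pseudo-metric space `BasedLoop E`). A theorem, not an instance (use via `haveI`). [cite: AizenmanBurchardDuke1999, §2.a p. 12] -/
theorem completeSpace [CompleteSpace E] : CompleteSpace (UnbasedLoop E) := by
  haveI := BasedLoop.completeSpace (E := E)
  infer_instance

/-- **`d`-chains converge.** If `d(u n, u (n+1)) ≤ d n` for DKKMO's unoriented distance
`d = udist` and `Σ d n < ∞`, then there is an unbased loop `v` with `d(u n, v) ≤ Σ_m d (n + m)`
for every `n`: re-orient the loops along the chain (`d(u, u') = dist u u'` or `dist u u'.reverse`)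
to obtain a Cauchy sequence for `dist`, and take its limit (`UnbasedLoop.completeSpace`). [folklore] -/
theorem exists_forall_udist_le_tsum [CompleteSpace E] {u : ℕ → UnbasedLoop E} {d : ℕ → ℝ}
    (hd : Summable d) (h : ∀ n, udist (u n) (u (n + 1)) ≤ d n) :
    ∃ v : UnbasedLoop E, ∀ n, udist (u n) v ≤ ∑' m, d (n + m) := by
  -- the re-oriented chain
  let w : ℕ → UnbasedLoop E := fun n ↦ Nat.rec (u 0)
    (fun n wn ↦ if dist wn (u (n + 1)) ≤ dist wn (u (n + 1)).reverse then u (n + 1)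
      else (u (n + 1)).reverse) n
  have hw_succ : ∀ n, w (n + 1) = if dist (w n) (u (n + 1)) ≤ dist (w n) (u (n + 1)).reverse
      then u (n + 1) else (u (n + 1)).reverse := fun n ↦ rfl
  have hw_or : ∀ n, w n = u n ∨ w n = (u n).reverse := by
    intro n
    cases n with
    | zero => exact Or.inl rfl
    | succ n =>
      rw [hw_succ]
      split_ifs
      · exact Or.inl rfl
      · exact Or.inr rfl
  have hw_udist : ∀ n v, udist (w n) v = udist (u n) v := fun n v ↦ by
    rcases hw_or n with h | h
    · rw [h]
    · rw [h, udist_reverse_left]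
  have hw_dist : ∀ n, dist (w n) (w (n + 1)) ≤ d n := by
    intro n
    have key : dist (w n) (w (n + 1)) = udist (w n) (u (n + 1)) := by
      rw [hw_succ, udist_def]
      split_ifs with hle
      · exact (min_eq_left hle).symm
      · exact (min_eq_right (le_of_not_ge hle)).symm
    rw [key, hw_udist]
    exact h n
  haveI := UnbasedLoop.completeSpace (E := E)
  obtain ⟨v, hv⟩ := cauchySeq_tendsto_of_complete (cauchySeq_of_dist_le_of_summable d hw_dist hd)
  refine ⟨v, fun n ↦ ?_⟩
  rw [← hw_udist]
  exact (udist_le_dist _ _).trans (dist_le_tsum_of_dist_le_of_tendsto d hw_dist hd hv n)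

/-- **`d`-chains converge, geometric form**: if `d(u n, u (n+1)) ≤ C / 2 / 2ⁿ` then some unbased
loop `v` has `d(u n, v) ≤ C / 2ⁿ` for every `n`. [folklore] -/
theorem exists_forall_udist_le_of_le_geometric_two [CompleteSpace E] {u : ℕ → UnbasedLoop E}
    {C : ℝ} (h : ∀ n, udist (u n) (u (n + 1)) ≤ C / 2 / 2 ^ n) :
    ∃ v : UnbasedLoop E, ∀ n, udist (u n) v ≤ C / 2 ^ n := by
  -- the same re-orientation, with Mathlib's geometric bookkeeping
  let w : ℕ → UnbasedLoop E := fun n ↦ Nat.rec (u 0)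
    (fun n wn ↦ if dist wn (u (n + 1)) ≤ dist wn (u (n + 1)).reverse then u (n + 1)
      else (u (n + 1)).reverse) n
  have hw_succ : ∀ n, w (n + 1) = if dist (w n) (u (n + 1)) ≤ dist (w n) (u (n + 1)).reverse
      then u (n + 1) else (u (n + 1)).reverse := fun n ↦ rfl
  have hw_or : ∀ n, w n = u n ∨ w n = (u n).reverse := by
    intro n
    cases n with
    | zero => exact Or.inl rfl
    | succ n =>
      rw [hw_succ]
      split_ifs
      · exact Or.inl rfl
      · exact Or.inr rfl
  have hw_udist : ∀ n v, udist (w n) v = udist (u n) v := fun n v ↦ by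
    rcases hw_or n with h | h
    · rw [h]
    · rw [h, udist_reverse_left]
  have hw_dist : ∀ n, dist (w n) (w (n + 1)) ≤ C / 2 / 2 ^ n := by
    intro n
    have key : dist (w n) (w (n + 1)) = udist (w n) (u (n + 1)) := by
      rw [hw_succ, udist_def]
      split_ifs with hle
      · exact (min_eq_left hle).symm
      · exact (min_eq_right (le_of_not_ge hle)).symm
    rw [key, hw_udist]
    exact h n
  haveI := UnbasedLoop.completeSpace (E := E)
  obtain ⟨v, hv⟩ := cauchySeq_tendsto_of_complete (cauchySeq_of_le_geometric_two hw_dist)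
  refine ⟨v, fun n ↦ ?_⟩
  rw [← hw_udist]
  exact (udist_le_dist _ _).trans (dist_le_of_le_geometric_two_of_tendsto hw_dist hv n)

end UnbasedLoop

end Literature.Probability.RandomPlanarGeometry

end
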